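import Summits.BirchSwinnertonDyer.Rank1Residual.Additive.RamifiedSevenRationalComparisonOfInputsR
import Summits.BirchSwinnertonDyer.Rank1Residual.Additive.RamifiedSevenPeriodPositionKernel
import HarnessLib

set_option autoImplicit false

/-!
# `𝒞₇` genus road (crux `EllipticUnitValueSevenOfGZK`, K7r), REPAIR ROW (C6-R) step 4: the K2ᶜ ASSEMBLY (KI) and the PERIOD-POSITION
# KERNEL (PK) PORTED over the re-typed datum `KatoExpDatum hγ Φ` — the pinned integral comparison (statement of zp v12's
# `stub_integralComparisonSeven`, VERBATIM) from the K2ᶜ INPUT FORM with `∃ D : KatoExpDatum hγ Φ`, «K2cPinned» from it, and the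
# (F-b) variants with the divisibility replaced by the integer inequality `jα ≤ 2e + 2k + a` — THEOREMS ONLY; nothing asserted

Cell bsd-cm, seat bsd-cm-prr-ty1 g34 (literature-prover), REPAIR ROW (C6-R) (pen bsd-cm-plan g37 D1009 (3) / D1011 / D1017 (A)): port of
`RamifiedSevenIntegralComparisonOfInputs.lean` (★ (KI), seat g30, p782137) and of the datum-reading §2–§3 of
`RamifiedSevenPeriodPositionKernel.lean` ((PK), p782511), whose theorems bind `D : DualExpValueDatum hγ Φ` — an EMPTY type (ERRATUM in
`RamifiedSevenGenusKatoExpDatum`, pen D1008) — and are vacuous as typed.  Proofs VERBATIM over the step-3 port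
(`periodScaledComparisonShape_of_katoExpDatum`); the datum-FREE lemmas of (KI)/(PK) (`integralComparisonShape_of_periodScaled_of_dvd`,
`PeriodPosition.pow_dvd_constZ_mul_of_le`, `PeriodPosition.cofactor_eq_of_isUnit`) are REUSED by import, not copied.  The two (PK)
predicates `PeriodPositionField(At) D` are written UNFOLDED here (`D.jα ≤ 2 * D.e + 2 * Φ.k + Φ.a`, resp.
`m₀ + D.jα ≤ 2 * D.e + 2 * Φ.k + Φ.a + m′`) so that this file declares no `Prop`-valued definition (kernel lane).
HONEST LABEL: conditional theorems; every hypothesis displayed; debt 0; no stub is closed here (the input form `h` is displayed, not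
inhabited); stmt-BirchSwinnertonDyer-19945 is OPEN; `X12.CMRamifiedSeven` is NOT proved; no summit statement is proved by this seat;
BSD is claimed for no curve.

## Contents
§1 `integralComparisonShape_of_katoExpDatum` (★′-R + divisibility + π-torsion-freeness); §2 ★ `integralComparisonSeven_of_katoExpInputs`
(the assembly zp v17 consumes: v12's letter VERBATIM from the input form over `KatoExpDatum`) and `k2cPinned_of_katoExpInputs`;
§3 (PK)-R: `KatoExpDatum.cZ_eq`, `KatoExpDatum.pow_dvd_cZ_mul_of_leAt` / `…_of_le` (the D916 divisibility from the integer
inequality, general / unit-`t` gauge), `integralComparisonShape_of_katoExpDatum_of_le` / `…_of_leAt`, and ★″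
`integralComparisonSeven_of_katoExpPeriodPositionInputs` (input form with last conjunct `IsUnit Φ.t ∧ D.jα ≤ 2·D.e + 2·Φ.k + Φ.a`).

References: K. Kato, Astérisque 295 (2004) §15.16 (15.16.1) / Prop. 15.17 (p. 265), 15.14 (p. 264), Prop. 15.9 (p. 258), Thm. 12.4
(2) / 12.5 (1) (p. 221), 13.5 (p. 227) [Kato2004Asterisque]; (KI) p782137, (PK) p782511, (R)-R step 3, (C6-R) step 2, (P1) p776025,
(P3) p776568; pen D914/D916/D1008–D1017; memo `Cruxes/EllipticUnitValueSevenOfGZK/DivisibilityKernel-g64.md` REV 1.1, `FbPreregistration-g65.md`.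
-/

noncomputable section

open scoped NumberField TensorProduct
open Field IsDedekindDomain NumberField Polynomial
open Literature.NumberTheory.GaloisRepresentations
open Literature.NumberTheory.EllipticCurves
open Literature.NumberTheory.EllipticCurves.Rank1Residual
open Literature.NumberTheory.EllipticCurves.IwasawaAlgebra
open Literature.NumberTheory.EllipticCurves.Kato2004
open Literature.NumberTheory.ComplexMultiplication.EllipticUnits
open Summit.BirchSwinnertonDyer.Rank1Residual

namespace Summit.BirchSwinnertonDyer.Rank1Residual.Additive.GenusSeven

/-! ## §1 The K2ᶜ input form at ONE pinned frame ⇒ `IntegralComparisonShape Φ`, over `KatoExpDatum` -/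

section Frame

variable {W : WeierstrassCurve ℚ} [W.IsElliptic] [W.IsGloballyMinimal] [Fact (Nat.Prime 7)]
  [ContinuousSMul ℤ_[7] (W.tateModule 7)] {K : ZpExtension ℚ 7} {hK : K.IsCyclotomic}
  {γ : Field.absoluteGaloisGroup ℚ} {I : IwasawaH1Data W 7 K γ}
  {F : GenusFrame} {θu : ∀ n : ℕ, globalUnitsOf (F.layer n)} {d : GenusDatum F θu}

/-- **The K2ᶜ input form at ONE pinned frame ⇒ `IntegralComparisonShape Φ`** (★′ of block (R) + the divisibility of its
explicit constant + `integralComparisonShape_of_periodScaled_of_dvd`).  CONDITIONAL; nothing asserted; 19945 OPEN.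
[cite: Kato2004Asterisque, (15.16.1) (p. 265), 15.14 (p. 264), Thm. 12.4 (2) (p. 221)] -/
theorem integralComparisonShape_of_katoExpDatum (hγ : K.IsTopGenerator γ) (Φ : PinnedKatoGenusFrame W K hK I d)
    (D : KatoExpDatum hγ Φ) (t' : Φ.R) (m₀ : ℕ) (ht : Φ.t * t' = Φ.π ^ m₀)
    (htf : ∀ (f : IwasawaAlgebra 7) (x : Φ.IK.H), f ≠ 0 → f • x = 0 → x = 0)
    (hrk : ∀ x y : Φ.IK.H, ∃ s r₀ r₁ : IwasawaAlgebra 7,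
      (s ≠ 0 ∨ r₀ ≠ 0 ∨ r₁ ≠ 0) ∧ s • x = r₀ • y + r₁ • Φ.piK y)
    (hχ : ∀ n : ℕ, ∃ χ : absoluteGaloisGroup Φ.Kcm →ₜ* ℂˣ,
      (∀ σ ∈ (K.restrictOfFinrankEqTwo (by decide) Φ.Kcm Φ.finrank_Kcm).layerSubgroup (n + 1), χ σ = 1) ∧
        IsPrimitiveRoot (((χ Φ.γK : ℂˣ)) : ℂ) (7 ^ (n + 1)))
    (hL : ∀ χ : absoluteGaloisGroup Φ.Kcm →ₜ* ℂˣ, ∃ Lf : ℂ → ℂ, CM.IsDepletedHeckeL Φ.ψ χ (7 * (7 * F.d)) Lf)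
    (hRoh : ∃ n₁ : ℕ, ∀ n : ℕ, n₁ ≤ n → ∀ χ : absoluteGaloisGroup Φ.Kcm →ₜ* ℂˣ,
      (∀ σ ∈ (K.restrictOfFinrankEqTwo (by decide) Φ.Kcm Φ.finrank_Kcm).layerSubgroup (n + 1), χ σ = 1) →
      IsPrimitiveRoot (((χ Φ.γK : ℂˣ)) : ℂ) (7 ^ (n + 1)) →
      ∀ Lf : ℂ → ℂ, CM.IsDepletedHeckeL Φ.ψ χ (7 * (7 * F.d)) Lf → Lf 1 ≠ 0)
    (hKI : Φ.π ^ (m₀ + 2 * D.jα) ∣ D.cZ * t') :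
    IntegralComparisonShape Φ :=
  integralComparisonShape_of_periodScaled_of_dvd Φ
    (periodScaledComparisonShape_of_katoExpDatum hγ Φ D t' m₀ ht htf hrk hχ hL hRoh) (hKI.mul_left _)

end Frame

/-! ## §2 ★ The assembly: the statement of `stub_integralComparisonSeven` from the K2ᶜ input form over `KatoExpDatum` -/

/-- ★ **`integralComparisonSeven_of_katoExpInputs` — THE PINNED INTEGRAL COMPARISON (statement of zp v12's `stub_integralComparisonSeven`,
VERBATIM) FROM THE K2ᶜ INPUT FORM** `h` (module docstring): for every `W ∈ 𝒞₇` and cyclotomic datum, a value-pinned `(F, θu)` such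
that every genus datum `d` carries a pinned frame `Φ`, a RE-TYPED dual-exponential value datum `D : KatoExpDatum hγ Φ`, `(t′, m₀)` with `t·t′ = π^{m₀}`, (tf),
(rk), characters of every primitive level, continuations, generic non-vanishing, AND the divisibility `π^{m₀ + 2jα} ∣ D.cZ·t′`.
This is the assembly the pen's zp v17 touch (T-art, D1016/D1017) uses: `stub_integralComparisonInputsSeven : <h>` re-pointed at
`KatoExpDatum`, the v12 letter derived from it by this theorem.  CONDITIONAL; nothing asserted; no stub closes; 19945 OPEN.
[cite: Kato2004Asterisque, §15.16 (15.16.1) (p. 265), 15.14 (p. 264), Prop. 15.9 (p. 258), Thm. 12.4 (2) / 12.5 (1) (p. 221), 13.5 (p. 227)] -/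
theorem integralComparisonSeven_of_katoExpInputs
    (h : exists_zetaClassPosition_of_rank_le_one → rank_eq_analyticRank_of_analyticRank_le_one →
      ∀ (W : WeierstrassCurve ℚ) [W.IsElliptic] [W.IsGloballyMinimal] [Fact (Nat.Prime 7)], X12.ClassCSeven W →
      letI : ContinuousSMul ℤ_[7] (W.tateModule 7) := TateModule.continuousSMul_padicInt
      ∀ (K : ZpExtension ℚ 7) (hK : K.IsCyclotomic) (γ : Field.absoluteGaloisGroup ℚ) (hγ : K.IsTopGenerator γ)
        (I : IwasawaH1Data W 7 K γ),
        ∃ (F : GenusFrame) (θu : ∀ n : ℕ, globalUnitsOf (F.layer n)), IsNormedEllipticUnitFamily F θu ∧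
          ∀ d : GenusDatum F θu, ∃ Φ : PinnedKatoGenusFrame W K hK I d, ∃ D : KatoExpDatum hγ Φ,
            ∃ (t' : Φ.R) (m₀ : ℕ), Φ.t * t' = Φ.π ^ m₀ ∧
            (∀ (f : IwasawaAlgebra 7) (x : Φ.IK.H), f ≠ 0 → f • x = 0 → x = 0) ∧
            (∀ x y : Φ.IK.H, ∃ s r₀ r₁ : IwasawaAlgebra 7,
              (s ≠ 0 ∨ r₀ ≠ 0 ∨ r₁ ≠ 0) ∧ s • x = r₀ • y + r₁ • Φ.piK y) ∧
            (∀ n : ℕ, ∃ χ : absoluteGaloisGroup Φ.Kcm →ₜ* ℂˣ,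
              (∀ σ ∈ (K.restrictOfFinrankEqTwo (by decide) Φ.Kcm Φ.finrank_Kcm).layerSubgroup (n + 1), χ σ = 1) ∧
                IsPrimitiveRoot (((χ Φ.γK : ℂˣ)) : ℂ) (7 ^ (n + 1))) ∧
            (∀ χ : absoluteGaloisGroup Φ.Kcm →ₜ* ℂˣ, ∃ Lf : ℂ → ℂ, CM.IsDepletedHeckeL Φ.ψ χ (7 * (7 * F.d)) Lf) ∧
            (∃ n₁ : ℕ, ∀ n : ℕ, n₁ ≤ n → ∀ χ : absoluteGaloisGroup Φ.Kcm →ₜ* ℂˣ,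
              (∀ σ ∈ (K.restrictOfFinrankEqTwo (by decide) Φ.Kcm Φ.finrank_Kcm).layerSubgroup (n + 1), χ σ = 1) →
              IsPrimitiveRoot (((χ Φ.γK : ℂˣ)) : ℂ) (7 ^ (n + 1)) →
              ∀ Lf : ℂ → ℂ, CM.IsDepletedHeckeL Φ.ψ χ (7 * (7 * F.d)) Lf → Lf 1 ≠ 0) ∧
            Φ.π ^ (m₀ + 2 * D.jα) ∣ D.cZ * t') :
    Kato2004.exists_zetaClassPosition_of_rank_le_one → rank_eq_analyticRank_of_analyticRank_le_one →
    ∀ (W : WeierstrassCurve ℚ) [W.IsElliptic] [W.IsGloballyMinimal] [Fact (Nat.Prime 7)], X12.ClassCSeven W →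
      letI : ContinuousSMul ℤ_[7] (W.tateModule 7) := TateModule.continuousSMul_padicInt
      ∀ (K : ZpExtension ℚ 7) (hK : K.IsCyclotomic) (γ : Field.absoluteGaloisGroup ℚ) (_ : K.IsTopGenerator γ)
        (I : IwasawaH1Data W 7 K γ),
        ∃ (F : GenusSeven.GenusFrame) (θu : ∀ n : ℕ, globalUnitsOf (F.layer n)), GenusSeven.IsNormedEllipticUnitFamily F θu ∧
          ∀ d : GenusSeven.GenusDatum F θu, ∃ Φ : GenusSeven.PinnedKatoGenusFrame W K hK I d,
            GenusSeven.IntegralComparisonShape Φ := by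
  intro hstar hGZK W _ _ _ hC K hK γ hγ I
  haveI : ContinuousSMul ℤ_[7] (W.tateModule 7) := TateModule.continuousSMul_padicInt
  obtain ⟨F, θu, hpin, hΦ⟩ := h hstar hGZK W hC K hK γ hγ I
  refine ⟨F, θu, hpin, fun d => ?_⟩
  obtain ⟨Φ, D, t', m₀, ht, htf, hrk, hχ, hL, hRoh, hKI⟩ := hΦ d
  exact ⟨Φ, integralComparisonShape_of_katoExpDatum hγ Φ D t' m₀ ht htf hrk hχ hL hRoh hKI⟩

/-- **… and hence «K2cPinned» and the v11 letter `ResidueIsGenusUnitClassShape`** from the same input form ((P3)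
`k2cPinned_of_integralComparison`).  CONDITIONAL; nothing asserted; 19945 OPEN. [cite: Kato2004Asterisque, §15.16 (15.16.1) (p. 265)] -/
theorem k2cPinned_of_katoExpInputs
    (h : exists_zetaClassPosition_of_rank_le_one → rank_eq_analyticRank_of_analyticRank_le_one →
      ∀ (W : WeierstrassCurve ℚ) [W.IsElliptic] [W.IsGloballyMinimal] [Fact (Nat.Prime 7)], X12.ClassCSeven W →
      letI : ContinuousSMul ℤ_[7] (W.tateModule 7) := TateModule.continuousSMul_padicInt
      ∀ (K : ZpExtension ℚ 7) (hK : K.IsCyclotomic) (γ : Field.absoluteGaloisGroup ℚ) (hγ : K.IsTopGenerator γ)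
        (I : IwasawaH1Data W 7 K γ),
        ∃ (F : GenusFrame) (θu : ∀ n : ℕ, globalUnitsOf (F.layer n)), IsNormedEllipticUnitFamily F θu ∧
          ∀ d : GenusDatum F θu, ∃ Φ : PinnedKatoGenusFrame W K hK I d, ∃ D : KatoExpDatum hγ Φ,
            ∃ (t' : Φ.R) (m₀ : ℕ), Φ.t * t' = Φ.π ^ m₀ ∧
            (∀ (f : IwasawaAlgebra 7) (x : Φ.IK.H), f ≠ 0 → f • x = 0 → x = 0) ∧
            (∀ x y : Φ.IK.H, ∃ s r₀ r₁ : IwasawaAlgebra 7,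
              (s ≠ 0 ∨ r₀ ≠ 0 ∨ r₁ ≠ 0) ∧ s • x = r₀ • y + r₁ • Φ.piK y) ∧
            (∀ n : ℕ, ∃ χ : absoluteGaloisGroup Φ.Kcm →ₜ* ℂˣ,
              (∀ σ ∈ (K.restrictOfFinrankEqTwo (by decide) Φ.Kcm Φ.finrank_Kcm).layerSubgroup (n + 1), χ σ = 1) ∧
                IsPrimitiveRoot (((χ Φ.γK : ℂˣ)) : ℂ) (7 ^ (n + 1))) ∧
            (∀ χ : absoluteGaloisGroup Φ.Kcm →ₜ* ℂˣ, ∃ Lf : ℂ → ℂ, CM.IsDepletedHeckeL Φ.ψ χ (7 * (7 * F.d)) Lf) ∧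
            (∃ n₁ : ℕ, ∀ n : ℕ, n₁ ≤ n → ∀ χ : absoluteGaloisGroup Φ.Kcm →ₜ* ℂˣ,
              (∀ σ ∈ (K.restrictOfFinrankEqTwo (by decide) Φ.Kcm Φ.finrank_Kcm).layerSubgroup (n + 1), χ σ = 1) →
              IsPrimitiveRoot (((χ Φ.γK : ℂˣ)) : ℂ) (7 ^ (n + 1)) →
              ∀ Lf : ℂ → ℂ, CM.IsDepletedHeckeL Φ.ψ χ (7 * (7 * F.d)) Lf → Lf 1 ≠ 0) ∧
            Φ.π ^ (m₀ + 2 * D.jα) ∣ D.cZ * t') :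
    exists_zetaClassPosition_of_rank_le_one → rank_eq_analyticRank_of_analyticRank_le_one →
      ∀ (W : WeierstrassCurve ℚ) [W.IsElliptic] [W.IsGloballyMinimal] [Fact (Nat.Prime 7)], X12.ClassCSeven W →
      letI : ContinuousSMul ℤ_[7] (W.tateModule 7) := TateModule.continuousSMul_padicInt
      ∀ (K : ZpExtension ℚ 7) (hK : K.IsCyclotomic) (γ : Field.absoluteGaloisGroup ℚ) (_ : K.IsTopGenerator γ)
        (I : IwasawaH1Data W 7 K γ),
        ∃ (F : GenusFrame) (θu : ∀ n : ℕ, globalUnitsOf (F.layer n)), IsNormedEllipticUnitFamily F θu ∧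
          ∀ d : GenusDatum F θu, ∃ Φ : PinnedKatoGenusFrame W K hK I d,
            ResidueIsGenusUnitClassShape Φ.toKatoGenusFrame :=
  k2cPinned_of_integralComparison (integralComparisonSeven_of_katoExpInputs h)

/-! ## §3 (PK)-R: the D916 divisibility from the integer inequality `jα (+ v_π t) ≤ 2e + 2k + a`, over `KatoExpDatum` -/

section Datum

variable {W : WeierstrassCurve ℚ} [W.IsElliptic] [W.IsGloballyMinimal] [Fact (Nat.Prime 7)]
  [ContinuousSMul ℤ_[7] (W.tateModule 7)] {K : ZpExtension ℚ 7} {hK : K.IsCyclotomic}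
  {γ : Field.absoluteGaloisGroup ℚ} {I : IwasawaH1Data W 7 K γ}
  {F : GenusFrame} {θu : ∀ n : ℕ, globalUnitsOf (F.layer n)} {d : GenusDatum F θu}
  {hγ : K.IsTopGenerator γ} {Φ : PinnedKatoGenusFrame W K hK I d}

/-- `D.cZ` with its casts normalised: `(α₀ − α₁π)·7^e·(A(uStar⁻¹)·(7^k·(u·π^a)))`. [cite: Kato2004Asterisque, (15.16.1) (p. 265)] -/
theorem KatoExpDatum.cZ_eq (D : KatoExpDatum hγ Φ) :
    D.cZ = (((D.α₀ : Φ.R) - (D.α₁ : Φ.R) * Φ.π) * (7 : Φ.R) ^ D.e) *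
      (algebraMap (IwasawaAlgebra 7) Φ.R (↑(D.uStar⁻¹) : IwasawaAlgebra 7) *
        ((7 : Φ.R) ^ Φ.k * ((Φ.u : Φ.R) * Φ.π ^ Φ.a))) := by
  simp only [KatoExpDatum.cZ, map_intCast, map_pow, map_ofNat, Int.cast_pow, Int.cast_ofNat]

/-- **The D916 divisibility input from the integer inequality, general gauge** (the (PK) predicate `PeriodPositionFieldAt`
written out): for any cofactor `t′ = w′·π^{m′}`, `m₀ + jα ≤ 2e + 2k + a + m′ ⟹ Φ.π ^ (m₀ + 2·jα) ∣ D.cZ * t′`.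
[cite: Kato2004Asterisque, (15.16.1) (p. 265)] -/
theorem KatoExpDatum.pow_dvd_cZ_mul_of_leAt (D : KatoExpDatum hγ Φ) (t' w' : Φ.R) (m₀ m' : ℕ)
    (ht' : t' = w' * Φ.π ^ m') (h : m₀ + D.jα ≤ 2 * D.e + 2 * Φ.k + Φ.a + m') :
    Φ.π ^ (m₀ + 2 * D.jα) ∣ D.cZ * t' := by
  have hle : m₀ + 2 * (D.α₀ ^ 2 + 7 * D.α₁ ^ 2).toNat.factorization 7 ≤
      (D.α₀ ^ 2 + 7 * D.α₁ ^ 2).toNat.factorization 7 + (2 * D.e + 2 * Φ.k + Φ.a) + m' := by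
    change m₀ + 2 * D.jα ≤ D.jα + (2 * D.e + 2 * Φ.k + Φ.a) + m'
    omega
  have key := PeriodPosition.pow_dvd_constZ_mul_of_le Φ.π (Φ.v : Φ.R) Φ.seven_eq D.α₀ D.α₁ D.e Φ.k Φ.a m₀ m'
    (algebraMap (IwasawaAlgebra 7) Φ.R (↑(D.uStar⁻¹) : IwasawaAlgebra 7)) (Φ.u : Φ.R) w' hle
  rw [D.cZ_eq, ht']
  exact key

/-- **Unit-`t` gauge** (the (PK) predicate `PeriodPositionField` written out): `t′ = w′·π^{m₀}` and `jα ≤ 2e + 2k + a ⟹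
Φ.π ^ (m₀ + 2·jα) ∣ D.cZ * t′`. [cite: Kato2004Asterisque, (15.16.1) (p. 265)] -/
theorem KatoExpDatum.pow_dvd_cZ_mul_of_le (D : KatoExpDatum hγ Φ) (t' w' : Φ.R) (m₀ : ℕ)
    (ht' : t' = w' * Φ.π ^ m₀) (h : D.jα ≤ 2 * D.e + 2 * Φ.k + Φ.a) :
    Φ.π ^ (m₀ + 2 * D.jα) ∣ D.cZ * t' :=
  D.pow_dvd_cZ_mul_of_leAt t' w' m₀ m₀ ht' (by omega)

/-- **`integralComparisonShape_of_katoExpDatum` with `hKI` replaced by `IsUnit Φ.t` and `jα ≤ 2e + 2k + a`** (unit-`t` gauge).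
CONDITIONAL; nothing asserted; 19945 OPEN. [cite: Kato2004Asterisque, (15.16.1) (p. 265), 15.14 (p. 264), Thm. 12.4 (2) (p. 221)] -/
theorem integralComparisonShape_of_katoExpDatum_of_le (hγ : K.IsTopGenerator γ) (Φ : PinnedKatoGenusFrame W K hK I d)
    (D : KatoExpDatum hγ Φ) (t' : Φ.R) (m₀ : ℕ) (ht : Φ.t * t' = Φ.π ^ m₀)
    (htf : ∀ (f : IwasawaAlgebra 7) (x : Φ.IK.H), f ≠ 0 → f • x = 0 → x = 0)
    (hrk : ∀ x y : Φ.IK.H, ∃ s r₀ r₁ : IwasawaAlgebra 7,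
      (s ≠ 0 ∨ r₀ ≠ 0 ∨ r₁ ≠ 0) ∧ s • x = r₀ • y + r₁ • Φ.piK y)
    (hχ : ∀ n : ℕ, ∃ χ : absoluteGaloisGroup Φ.Kcm →ₜ* ℂˣ,
      (∀ σ ∈ (K.restrictOfFinrankEqTwo (by decide) Φ.Kcm Φ.finrank_Kcm).layerSubgroup (n + 1), χ σ = 1) ∧
        IsPrimitiveRoot (((χ Φ.γK : ℂˣ)) : ℂ) (7 ^ (n + 1)))
    (hL : ∀ χ : absoluteGaloisGroup Φ.Kcm →ₜ* ℂˣ, ∃ Lf : ℂ → ℂ, CM.IsDepletedHeckeL Φ.ψ χ (7 * (7 * F.d)) Lf)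
    (hRoh : ∃ n₁ : ℕ, ∀ n : ℕ, n₁ ≤ n → ∀ χ : absoluteGaloisGroup Φ.Kcm →ₜ* ℂˣ,
      (∀ σ ∈ (K.restrictOfFinrankEqTwo (by decide) Φ.Kcm Φ.finrank_Kcm).layerSubgroup (n + 1), χ σ = 1) →
      IsPrimitiveRoot (((χ Φ.γK : ℂˣ)) : ℂ) (7 ^ (n + 1)) →
      ∀ Lf : ℂ → ℂ, CM.IsDepletedHeckeL Φ.ψ χ (7 * (7 * F.d)) Lf → Lf 1 ≠ 0)
    (htu : IsUnit Φ.t) (hPP : D.jα ≤ 2 * D.e + 2 * Φ.k + Φ.a) :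
    IntegralComparisonShape Φ :=
  integralComparisonShape_of_katoExpDatum hγ Φ D t' m₀ ht htf hrk hχ hL hRoh
    (D.pow_dvd_cZ_mul_of_le t' _ m₀ (PeriodPosition.cofactor_eq_of_isUnit ht htu) hPP)

/-- **General gauge**: `hKI` replaced by a factorisation `t′ = w′·π^{m′}` and `m₀ + jα ≤ 2e + 2k + a + m′`.
CONDITIONAL; nothing asserted; 19945 OPEN. [cite: Kato2004Asterisque, (15.16.1) (p. 265), 15.14 (p. 264), Thm. 12.4 (2) (p. 221)] -/
theorem integralComparisonShape_of_katoExpDatum_of_leAt (hγ : K.IsTopGenerator γ) (Φ : PinnedKatoGenusFrame W K hK I d)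
    (D : KatoExpDatum hγ Φ) (t' : Φ.R) (m₀ : ℕ) (ht : Φ.t * t' = Φ.π ^ m₀)
    (htf : ∀ (f : IwasawaAlgebra 7) (x : Φ.IK.H), f ≠ 0 → f • x = 0 → x = 0)
    (hrk : ∀ x y : Φ.IK.H, ∃ s r₀ r₁ : IwasawaAlgebra 7,
      (s ≠ 0 ∨ r₀ ≠ 0 ∨ r₁ ≠ 0) ∧ s • x = r₀ • y + r₁ • Φ.piK y)
    (hχ : ∀ n : ℕ, ∃ χ : absoluteGaloisGroup Φ.Kcm →ₜ* ℂˣ,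
      (∀ σ ∈ (K.restrictOfFinrankEqTwo (by decide) Φ.Kcm Φ.finrank_Kcm).layerSubgroup (n + 1), χ σ = 1) ∧
        IsPrimitiveRoot (((χ Φ.γK : ℂˣ)) : ℂ) (7 ^ (n + 1)))
    (hL : ∀ χ : absoluteGaloisGroup Φ.Kcm →ₜ* ℂˣ, ∃ Lf : ℂ → ℂ, CM.IsDepletedHeckeL Φ.ψ χ (7 * (7 * F.d)) Lf)
    (hRoh : ∃ n₁ : ℕ, ∀ n : ℕ, n₁ ≤ n → ∀ χ : absoluteGaloisGroup Φ.Kcm →ₜ* ℂˣ,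
      (∀ σ ∈ (K.restrictOfFinrankEqTwo (by decide) Φ.Kcm Φ.finrank_Kcm).layerSubgroup (n + 1), χ σ = 1) →
      IsPrimitiveRoot (((χ Φ.γK : ℂˣ)) : ℂ) (7 ^ (n + 1)) →
      ∀ Lf : ℂ → ℂ, CM.IsDepletedHeckeL Φ.ψ χ (7 * (7 * F.d)) Lf → Lf 1 ≠ 0)
    (w' : Φ.R) (m' : ℕ) (ht' : t' = w' * Φ.π ^ m') (hPP : m₀ + D.jα ≤ 2 * D.e + 2 * Φ.k + Φ.a + m') :
    IntegralComparisonShape Φ :=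
  integralComparisonShape_of_katoExpDatum hγ Φ D t' m₀ ht htf hrk hχ hL hRoh
    (D.pow_dvd_cZ_mul_of_leAt t' w' m₀ m' ht' hPP)

end Datum

/-- ★″ **`integralComparisonSeven_of_katoExpPeriodPositionInputs`** — zp v12's letter (VERBATIM) from the input form over
`KatoExpDatum` with its last conjunct `Φ.π ^ (m₀ + 2 * D.jα) ∣ D.cZ * t′` replaced by `IsUnit Φ.t ∧ D.jα ≤ 2 * D.e + 2 * Φ.k + Φ.a`
(the (F-b) letter; the pre-registration predicts EQUALITY on genuine data).  An ALTERNATIVE residual letter for the pen.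
CONDITIONAL; nothing asserted; no stub closes; 19945 OPEN; BSD claimed for no curve.
[cite: Kato2004Asterisque, §15.16 (15.16.1) (p. 265), 15.14 (p. 264), Prop. 15.9 (p. 258), Thm. 12.4 (2) / 12.5 (1) (p. 221)] -/
theorem integralComparisonSeven_of_katoExpPeriodPositionInputs
    (h : exists_zetaClassPosition_of_rank_le_one → rank_eq_analyticRank_of_analyticRank_le_one →
      ∀ (W : WeierstrassCurve ℚ) [W.IsElliptic] [W.IsGloballyMinimal] [Fact (Nat.Prime 7)], X12.ClassCSeven W →
      letI : ContinuousSMul ℤ_[7] (W.tateModule 7) := TateModule.continuousSMul_padicInt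
      ∀ (K : ZpExtension ℚ 7) (hK : K.IsCyclotomic) (γ : Field.absoluteGaloisGroup ℚ) (hγ : K.IsTopGenerator γ)
        (I : IwasawaH1Data W 7 K γ),
        ∃ (F : GenusFrame) (θu : ∀ n : ℕ, globalUnitsOf (F.layer n)), IsNormedEllipticUnitFamily F θu ∧
          ∀ d : GenusDatum F θu, ∃ Φ : PinnedKatoGenusFrame W K hK I d, ∃ D : KatoExpDatum hγ Φ,
            ∃ (t' : Φ.R) (m₀ : ℕ), Φ.t * t' = Φ.π ^ m₀ ∧
            (∀ (f : IwasawaAlgebra 7) (x : Φ.IK.H), f ≠ 0 → f • x = 0 → x = 0) ∧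
            (∀ x y : Φ.IK.H, ∃ s r₀ r₁ : IwasawaAlgebra 7,
              (s ≠ 0 ∨ r₀ ≠ 0 ∨ r₁ ≠ 0) ∧ s • x = r₀ • y + r₁ • Φ.piK y) ∧
            (∀ n : ℕ, ∃ χ : absoluteGaloisGroup Φ.Kcm →ₜ* ℂˣ,
              (∀ σ ∈ (K.restrictOfFinrankEqTwo (by decide) Φ.Kcm Φ.finrank_Kcm).layerSubgroup (n + 1), χ σ = 1) ∧
                IsPrimitiveRoot (((χ Φ.γK : ℂˣ)) : ℂ) (7 ^ (n + 1))) ∧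
            (∀ χ : absoluteGaloisGroup Φ.Kcm →ₜ* ℂˣ, ∃ Lf : ℂ → ℂ, CM.IsDepletedHeckeL Φ.ψ χ (7 * (7 * F.d)) Lf) ∧
            (∃ n₁ : ℕ, ∀ n : ℕ, n₁ ≤ n → ∀ χ : absoluteGaloisGroup Φ.Kcm →ₜ* ℂˣ,
              (∀ σ ∈ (K.restrictOfFinrankEqTwo (by decide) Φ.Kcm Φ.finrank_Kcm).layerSubgroup (n + 1), χ σ = 1) →
              IsPrimitiveRoot (((χ Φ.γK : ℂˣ)) : ℂ) (7 ^ (n + 1)) →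
              ∀ Lf : ℂ → ℂ, CM.IsDepletedHeckeL Φ.ψ χ (7 * (7 * F.d)) Lf → Lf 1 ≠ 0) ∧
            IsUnit Φ.t ∧ D.jα ≤ 2 * D.e + 2 * Φ.k + Φ.a) :
    Kato2004.exists_zetaClassPosition_of_rank_le_one → rank_eq_analyticRank_of_analyticRank_le_one →
    ∀ (W : WeierstrassCurve ℚ) [W.IsElliptic] [W.IsGloballyMinimal] [Fact (Nat.Prime 7)], X12.ClassCSeven W →
      letI : ContinuousSMul ℤ_[7] (W.tateModule 7) := TateModule.continuousSMul_padicInt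
      ∀ (K : ZpExtension ℚ 7) (hK : K.IsCyclotomic) (γ : Field.absoluteGaloisGroup ℚ) (_ : K.IsTopGenerator γ)
        (I : IwasawaH1Data W 7 K γ),
        ∃ (F : GenusSeven.GenusFrame) (θu : ∀ n : ℕ, globalUnitsOf (F.layer n)), GenusSeven.IsNormedEllipticUnitFamily F θu ∧
          ∀ d : GenusSeven.GenusDatum F θu, ∃ Φ : GenusSeven.PinnedKatoGenusFrame W K hK I d,
            GenusSeven.IntegralComparisonShape Φ := by
  intro hstar hGZK W _ _ _ hC K hK γ hγ I
  haveI : ContinuousSMul ℤ_[7] (W.tateModule 7) := TateModule.continuousSMul_padicInt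
  obtain ⟨F, θu, hpin, hΦ⟩ := h hstar hGZK W hC K hK γ hγ I
  refine ⟨F, θu, hpin, fun d => ?_⟩
  obtain ⟨Φ, D, t', m₀, ht, htf, hrk, hχ, hL, hRoh, htu, hPP⟩ := hΦ d
  exact ⟨Φ, integralComparisonShape_of_katoExpDatum_of_le hγ Φ D t' m₀ ht htf hrk hχ hL hRoh htu hPP⟩

end Summit.BirchSwinnertonDyer.Rank1Residual.Additive.GenusSeven

end
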